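import Literature.NumberTheory.Automorphic.LocalPiSchwartzBruhatPlancherel
import HarnessLib

/-!
# Uniqueness of the Fourier–Stieltjes transform along a map into `F^ι` (non-archimedean place)

Topic `NumberTheory/Automorphic`; namespace `Literature.NumberTheory.Automorphic`.  KERNEL ONLY: theorems, 0 definitions,
0 records, 0 named facts, 0 `sorry`.

Let `F` be a non-archimedean local field, `ι` a finite index type, `ψ` a continuous non-trivial additive character of
`F`, and let `(X, ν)` be ANY s-finite measure space carrying an integrable function `Φ : X → ℂ` and a measurable map
`Q : X → F^ι`.  The complex measure `Q_*(Φ ν)` on `F^ι` has Fourier–Stieltjes transform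
`η ↦ ∫_X ψ(⟨Q x, η⟩) Φ(x) dν(x)`.  This file proves the UNIQUENESS THEOREM in the form the tree's Schwartz–Bruhat
calculus makes natural:

* **`integral_comp_mul_eq_zero_of_forall_integral_addChar_eq_zero`** (§1) — if `∫_X ψ(⟨Q x, η⟩) Φ(x) dν = 0` for
  every `η ∈ F^ι`, then `∫_X g(Q x) Φ(x) dν = 0` for every Schwartz–Bruhat `g ∈ 𝒮(F^ι)`.  Proof: write `g` as the
  Fourier transform of `ĝ(-·)` for a self-dual Haar measure ([WeilBNT1967, Ch. VII §2, Cor. 1/3], tree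
  `exists_isAddHaarMeasure_piFourierSB_piFourierSB_eq_reflect`), exchange the two integrals (Fubini: `ĝ` is
  Schwartz–Bruhat, `Φ` integrable, `|ψ| = 1`), and apply the hypothesis at `-t` inside;
* `setIntegral_preimage_vadd_piPrimePowBall_eq_zero` (§2) — in particular `∫_{Q⁻¹(a + (𝔭^N)^ι)} Φ dν = 0` for every
  coset of every box: the measure `Q_*(Φ ν)` vanishes on the compact open sets (which generate the Borel sets).

This is the non-archimedean several-variables case of the classical injectivity of `μ ↦ μ̂` on bounded complex measures
of a locally compact abelian group ([WeilBNT1967, Ch. VII §2] for the self-dual Haar measure and inversion on standard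
functions; the uniqueness statement is e.g. [Folland1995, Prop. 4.33] / Bochner's theorem context), written «along a
map `Q`» so that no topology or product structure on `X` is needed.

Written for the cell `hodgecm-mathlib` (fan B, rung B-IV, KEY `b4-howe-compact-irreducible`, proof node D7 of
`MoeglinVignerasWaldspurger1987.mvw_IV4_rankOne_irreducibleOrZero`): in the doubling see-saw for the pair
`(U(1), U(V))` the Siegel–Weil section `φ ↦ (g ↦ (ω(g)φ)(0))` of `𝒮(V)` into the degenerate principal series of
`U(V ⊕ -V)` is, on the unipotent radical `n(b)` followed by the long Weyl element, `b ↦ ∫_V ψ(⟨b, x x*⟩) φ(x) dx` —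
the Fourier–Stieltjes transform of `μ_*(φ dx)` for the moment map `μ : V → Herm_N(E_v)`, `x ↦ x x*`; §1–§2 with
`Q = μ` give its injectivity on `U(1)`-invariant `φ`.  Nothing about theta lifts is asserted here.

## References
* [WeilBNT1967] A. Weil, *Basic Number Theory* (1967), Chap. VII §2, Prop. 2, Cor. 1–3 (standard functions on a
  vector space over a `p`-field, Fourier inversion, self-dual measure).
* [Folland1995] G. B. Folland, *A Course in Abstract Harmonic Analysis* (1995), §4.2–4.3 (Fourier uniqueness for
  `M(G)`).
-/

set_option autoImplicit false

noncomputable section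

open _root_.MeasureTheory _root_.MeasureTheory.Measure Set Function
open scoped Pointwise

namespace Literature.NumberTheory.Automorphic

open Literature.NumberTheory.GaloisRepresentations.IsNonarchimedeanLocalField

variable {F : Type*} [Field F] [ValuativeRel F] [TopologicalSpace F] [IsNonarchimedeanLocalField F]
  {ι : Type*} [Fintype ι] [MeasurableSpace (ι → F)] [BorelSpace (ι → F)]
  {ψ : AddChar F Circle}
  {X : Type*} [MeasurableSpace X] (ν : Measure X) [SFinite ν]

/-! ## §0 Topological bookkeeping on `F^ι` (local instances) -/

omit [MeasurableSpace (ι → F)] [BorelSpace (ι → F)] in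
/-- `F^ι` is second countable. [folklore] -/
private theorem secondCountableTopology_pi' : SecondCountableTopology (ι → F) := by
  haveI : SecondCountableTopology F := secondCountableTopology_localField F
  infer_instance

omit [Fintype ι] [MeasurableSpace (ι → F)] [BorelSpace (ι → F)] in
/-- `F^ι` is locally compact. [folklore] -/
private theorem locallyCompactSpace_pi' [Finite ι] : LocallyCompactSpace (ι → F) := by
  haveI : LocallyCompactSpace F := inferInstance
  infer_instance

/-! ## §1 Vanishing Fourier–Stieltjes transform ⇒ vanishing against every Schwartz–Bruhat function -/

omit [SFinite ν] in
/-- the Fubini kernel `(x, t) ↦ ψ(⟨t, -Q x⟩) G(t) Φ(x)` is integrable on `X × F^ι` for `Φ` integrable on `X`, `G`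
Schwartz–Bruhat on `F^ι` and `Q` measurable (it is dominated by `|Φ(x)| |G(t)|`). [cite: WeilBNT1967, Ch. VII §2, Prop. 2] -/
theorem integrable_addChar_comp_mul_mul (μ : Measure (ι → F)) [IsFiniteMeasureOnCompacts μ] [SFinite μ]
    (hψ : ψ.IsContinuousNontrivial) {Φ : X → ℂ} (hΦ : Integrable Φ ν) {Q : X → ι → F} (hQ : Measurable Q)
    {G : (ι → F) → ℂ} (hG : G ∈ SchwartzBruhat (ι → F)) :
    Integrable (uncurry fun (x : X) (t : ι → F) => ((ψ (t ⬝ᵥ (-Q x)) : Circle) : ℂ) * G t * Φ x) (ν.prod μ) := by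
  haveI := secondCountableTopology_pi' (F := F) (ι := ι)
  -- the dominating integrable function `|Φ(x)| |G(t)|`
  have hGint : Integrable G μ := hG.1.continuous.integrable_of_hasCompactSupport hG.2
  have hdom : Integrable (fun z : X × (ι → F) => Φ z.1 * G z.2) (ν.prod μ) := hΦ.mul_prod hGint
  -- measurability of the kernel
  have hK : Continuous fun p : (ι → F) × (ι → F) => ((ψ (p.2 ⬝ᵥ (-p.1)) : Circle) : ℂ) :=
    continuous_subtype_val.comp (hψ.1.comp (continuous_snd.dotProduct continuous_fst.neg))
  have hmeas : AEStronglyMeasurable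
      (uncurry fun (x : X) (t : ι → F) => ((ψ (t ⬝ᵥ (-Q x)) : Circle) : ℂ) * G t * Φ x) (ν.prod μ) := by
    have h1 : Measurable fun z : X × (ι → F) => ((ψ (z.2 ⬝ᵥ (-Q z.1)) : Circle) : ℂ) :=
      hK.measurable.comp ((hQ.comp measurable_fst).prodMk measurable_snd)
    have h2 : AEStronglyMeasurable (fun z : X × (ι → F) => G z.2) (ν.prod μ) :=
      hG.1.continuous.aestronglyMeasurable.comp_snd
    have h3 : AEStronglyMeasurable (fun z : X × (ι → F) => Φ z.1) (ν.prod μ) := hΦ.aestronglyMeasurable.comp_fst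
    exact (h1.aestronglyMeasurable.mul h2).mul h3
  refine hdom.mono hmeas (Filter.Eventually.of_forall fun z => ?_)
  simp only [uncurry, norm_mul, Circle.norm_coe, one_mul]
  rw [mul_comm]

/-- **Uniqueness of the Fourier–Stieltjes transform along `Q`.**  If `Φ` is `ν`-integrable on `X`, `Q : X → F^ι` is
measurable and `∫_X ψ(⟨Q x, η⟩) Φ(x) dν = 0` for every `η ∈ F^ι`, then `∫_X g(Q x) Φ(x) dν = 0` for every
Schwartz–Bruhat `g` on `F^ι` (Fourier inversion for a self-dual Haar measure + Fubini).
[cite: WeilBNT1967, Ch. VII §2, Cor. 1] -/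
theorem integral_comp_mul_eq_zero_of_forall_integral_addChar_eq_zero (hψ : ψ.IsContinuousNontrivial)
    {Φ : X → ℂ} (hΦ : Integrable Φ ν) {Q : X → ι → F} (hQ : Measurable Q)
    (h : ∀ η : ι → F, ∫ x, ((ψ (Q x ⬝ᵥ η) : Circle) : ℂ) * Φ x ∂ν = 0)
    {g : (ι → F) → ℂ} (hg : g ∈ SchwartzBruhat (ι → F)) :
    ∫ x, g (Q x) * Φ x ∂ν = 0 := by
  haveI := secondCountableTopology_pi' (F := F) (ι := ι)
  haveI := locallyCompactSpace_pi' (F := F) (ι := ι)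
  -- a self-dual Haar measure: `(ĝ)̂ = g(-·)`
  obtain ⟨μ, hμ, hinv⟩ := exists_isAddHaarMeasure_piFourierSB_piFourierSB_eq_reflect (ι := ι) hψ
  haveI := hμ
  set G : (ι → F) → ℂ := piFourierSB ψ μ g with hGdef
  have hG : G ∈ SchwartzBruhat (ι → F) := piFourierSB_mem_schwartzBruhat μ hψ hg
  -- `g (Q x) = ∫_t ψ(⟨t, -Q x⟩) G(t) dμ`
  have hgQ : ∀ x, g (Q x) = ∫ t, ((ψ (t ⬝ᵥ (-Q x)) : Circle) : ℂ) * G t ∂μ := by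
    intro x
    have e := congr_fun (hinv g hg) (-Q x)
    rw [neg_neg] at e
    rw [← e, piFourierSB_apply]
  -- Fubini
  have hswap := integral_integral_swap (integrable_addChar_comp_mul_mul ν μ hψ hΦ hQ hG)
  calc ∫ x, g (Q x) * Φ x ∂ν
      = ∫ x, ∫ t, ((ψ (t ⬝ᵥ (-Q x)) : Circle) : ℂ) * G t * Φ x ∂μ ∂ν := by
        refine integral_congr_ae (Filter.Eventually.of_forall fun x => ?_)
        simp only
        rw [hgQ x, ← integral_mul_const]
    _ = ∫ t, ∫ x, ((ψ (t ⬝ᵥ (-Q x)) : Circle) : ℂ) * G t * Φ x ∂ν ∂μ := hswap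
    _ = ∫ t, G t * ∫ x, ((ψ (Q x ⬝ᵥ (-t)) : Circle) : ℂ) * Φ x ∂ν ∂μ := by
        refine integral_congr_ae (Filter.Eventually.of_forall fun t => ?_)
        simp only
        rw [← integral_const_mul]
        refine integral_congr_ae (Filter.Eventually.of_forall fun x => ?_)
        simp only
        rw [dotProduct_neg, dotProduct_comm, ← dotProduct_neg]
        ring
    _ = 0 := by
        simp only [h, mul_zero, integral_zero]

/-! ## §2 The push-forward measure vanishes on compact open sets -/

/-- **`∫_{Q⁻¹(a + (𝔭^N)^ι)} Φ dν = 0` for every coset of every box** (§1 applied to the Schwartz–Bruhat indicator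
`1_{a+(𝔭^N)^ι}`). [cite: WeilBNT1967, Ch. VII §2, Cor. 1] -/
theorem setIntegral_preimage_vadd_piPrimePowBall_eq_zero (hψ : ψ.IsContinuousNontrivial)
    {Φ : X → ℂ} (hΦ : Integrable Φ ν) {Q : X → ι → F} (hQ : Measurable Q)
    (h : ∀ η : ι → F, ∫ x, ((ψ (Q x ⬝ᵥ η) : Circle) : ℂ) * Φ x ∂ν = 0) (a : ι → F) (N : ℤ) :
    ∫ x in Q ⁻¹' (a +ᵥ piPrimePowBall F ι N), Φ x ∂ν = 0 := by
  have hmeas : MeasurableSet (Q ⁻¹' (a +ᵥ piPrimePowBall F ι N)) := hQ (measurableSet_vadd_piPrimePowBall N a)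
  rw [← integral_indicator hmeas]
  have key := integral_comp_mul_eq_zero_of_forall_integral_addChar_eq_zero ν hψ hΦ hQ h
    (indicator_vadd_piPrimePowBall_mem_schwartzBruhat N a (1 : ℂ))
  rw [← key]
  refine integral_congr_ae (Filter.Eventually.of_forall fun x => ?_)
  simp only
  by_cases hx : Q x ∈ a +ᵥ piPrimePowBall F ι N
  · rw [Set.indicator_of_mem (show x ∈ Q ⁻¹' (a +ᵥ piPrimePowBall F ι N) from hx), Set.indicator_of_mem hx, one_mul]
  · rw [Set.indicator_of_notMem (show x ∉ Q ⁻¹' (a +ᵥ piPrimePowBall F ι N) from hx), Set.indicator_of_notMem hx,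
      zero_mul]

/-- the same for the boxes themselves (`a = 0`). [cite: WeilBNT1967, Ch. VII §2, Cor. 1] -/
theorem setIntegral_preimage_piPrimePowBall_eq_zero (hψ : ψ.IsContinuousNontrivial)
    {Φ : X → ℂ} (hΦ : Integrable Φ ν) {Q : X → ι → F} (hQ : Measurable Q)
    (h : ∀ η : ι → F, ∫ x, ((ψ (Q x ⬝ᵥ η) : Circle) : ℂ) * Φ x ∂ν = 0) (N : ℤ) :
    ∫ x in Q ⁻¹' piPrimePowBall F ι N, Φ x ∂ν = 0 := by
  have h0 := setIntegral_preimage_vadd_piPrimePowBall_eq_zero ν hψ hΦ hQ h 0 N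
  rw [zero_vadd] at h0
  exact h0

end Literature.NumberTheory.Automorphic

end
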